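import Literature.Analysis.OperatorTheory.YangMillsMatrixModelComparisonCalculus
import Literature.Analysis.OperatorTheory.YangMillsMatrixModelGroundStateComparison
import HarnessLib

/-!
# A quartic-Gaussian LOWER bound for positive eigenfunctions of Lüscher's matrix-model Hamiltonian (elementary comparison principle)

Topic `Literature/Analysis/OperatorTheory`.  For Lüscher's effective Hamiltonian `𝔥 = −½Δ + V` on `ℝ⁹` (`V = luscherPotential`, the quartic
`¼ Σ_{i,j}|x_i × x_j|²`, which VANISHES on the 5-dimensional cone of parallel triples reaching infinity) and a positive classical solution `ψ > 0`,
`ψ ∈ C²`, of `𝔥ψ = Eψ` (any real `E`): for every `a > 0` there is `c > 0` with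

  `ψ(y) ≥ c · exp(−a‖y‖⁴)` for all `y`    (`groundState_lower_bound_quartic`),

more precisely `ψ(y) ≥ m₀ · exp(−a(1+‖y‖²)²)` with `m₀ = min_{‖y‖ ≤ r₀} ψ`, `r₀ = 1 + (¼ + |E| + 40a)/(8a²)` (`groundState_lower_bound_bracket`).
A weak (quartic instead of Carmona–Simon's sharp cubic `exp(−a|y|³)` for `V = O(|y|⁴)`) but ELEMENTARY version of the classical lower bounds for
ground states [Carmona–Simon, CMP 80 (1981) 59–98; Agmon's notes, Ch. 5, remarks pp. 81–82 citing [6] and Hoffmann-Ostenhof [16] (comparison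
arguments)]: no Feynman–Kac formula, no Harnack inequality, no Agmon metric, NO decay hypothesis on `ψ`, NO sign of `E`.  PROOF:
* the **quotient maximum principle** is the tree's `le_of_strict_subsolution` (`YangMillsMatrixModelGroundStateComparison.lean`, seat
  ym-20205-polyakovlift-s1 g3, landed concurrently): a STRICT subsolution `(𝔥 − E)φ < 0` on an open `Ω` inside a compact `K` with `φ ≤ ψ` on `K ∖ Ω`
  satisfies `φ ≤ ψ` on `K` — the maximum of `φ/ψ`, if `> 1`, is interior, where `∇(φ/ψ) = 0`, `Δ(φ/ψ) ≤ 0` force `(𝔥 − E)φ = −½ψΔ(φ/ψ) ≥ 0`;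
  the classically allowed valleys `{V < E}` (`luscherPotential_parallel`) play no role;
* §1 here: on each annulus `r₀ ≤ ‖y‖ ≤ R₁` the function `φ_{R₁} = m₀(e^{−a(1+‖y‖²)²} − e^{−a(1+R₁²)²})` is a strict subsolution (`annulusCmp_strictSub`, from
  `V ≤ ¼‖y‖⁴` and `8a²(1+r²)²r² > 2a(11r²+9) + ¼r⁴ + |E|` for `r > r₀`), `≤ m₀ ≤ ψ` on the inner sphere and `= 0` on the outer one; then `R₁ → ∞`.
Consumer: the one-site transplant observables `χ_R f_{i+1}/f₀` of route `LuscherReduction`, line «polyakovlift» (crux `DressedRitz`, r7 stub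
`stub_groundStateLowerBound`), which need `inf_{‖y‖ ≤ √2R} f₀` against an `e^{−c/Λ}` budget.

All theorems, 0 sorry, no definitions, no named facts.  [cite: CarmonaSimon1981, §1] [cite: Agmon1982, Ch. 5, remarks pp. 81–82]
-/

noncomputable section

open MeasureTheory Filter Topology Function Metric Matrix
open scoped BigOperators

namespace Literature.Analysis.OperatorTheory.YMMatrixModel

/-! ### §1. The strict subsolution on annuli and the lower bound -/

section LowerBound

variable (a : ℝ)

/-- The annulus comparison function `φ_{R₁}(y) = m (e^{−a(1+‖y‖²)²} − e^{−a(1+R₁²)²})` is `C²`. [cite: Agmon1982, Ch. 5, remarks pp. 81–82] -/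
theorem contDiff_annulusCmp (m R₁ : ℝ) :
    ContDiff ℝ 2 fun y : ZM => m * (Real.exp (-(a * (1 + ‖y‖ ^ 2) ^ 2)) - Real.exp (-(a * (1 + R₁ ^ 2) ^ 2))) :=
  contDiff_const.mul ((contDiff_cmp a).sub contDiff_const)

/-- Its Laplacian: `Δφ_{R₁} = m · Δ e^{−a(1+‖y‖²)²}`. [cite: Agmon1982, Ch. 5, remarks pp. 81–82] -/
theorem laplacian_annulusCmp (m R₁ : ℝ) (x : ZM) :
    laplacian (fun y : ZM => m * (Real.exp (-(a * (1 + ‖y‖ ^ 2) ^ 2)) - Real.exp (-(a * (1 + R₁ ^ 2) ^ 2)))) x =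
      m * (Real.exp (-(a * (1 + ‖x‖ ^ 2) ^ 2)) * (16 * a ^ 2 * (1 + ‖x‖ ^ 2) ^ 2 * ‖x‖ ^ 2 - 4 * a * (11 * ‖x‖ ^ 2 + 9))) := by
  have hφ := differentiable_cmp a
  have hφ' : ∀ p, Differentiable ℝ (pderiv p fun y : ZM => Real.exp (-(a * (1 + ‖y‖ ^ 2) ^ 2))) := fun p =>
    differentiable_pderiv_of_contDiff_two (contDiff_cmp a) p
  -- first derivatives
  have e1 : ∀ p, pderiv p (fun y : ZM => m * (Real.exp (-(a * (1 + ‖y‖ ^ 2) ^ 2)) - Real.exp (-(a * (1 + R₁ ^ 2) ^ 2)))) =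
      fun y => m * pderiv p (fun y : ZM => Real.exp (-(a * (1 + ‖y‖ ^ 2) ^ 2))) y := by
    intro p
    funext y
    have hsub : Differentiable ℝ fun y : ZM => Real.exp (-(a * (1 + ‖y‖ ^ 2) ^ 2)) - Real.exp (-(a * (1 + R₁ ^ 2) ^ 2)) :=
      hφ.sub (differentiable_const _)
    rw [pderiv_fun_const_mul hsub]
    congr 1
    have e : (fun y : ZM => Real.exp (-(a * (1 + ‖y‖ ^ 2) ^ 2)) - Real.exp (-(a * (1 + R₁ ^ 2) ^ 2))) =
        fun y => Real.exp (-(a * (1 + ‖y‖ ^ 2) ^ 2)) + (-Real.exp (-(a * (1 + R₁ ^ 2) ^ 2))) := by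
      funext z; ring
    rw [e, pderiv_fun_add hφ (differentiable_const _), pderiv_const', add_zero]
  rw [laplacian_def, laplacian_cmp a x |>.symm, laplacian_def, Finset.mul_sum]
  refine Finset.sum_congr rfl fun p _ => ?_
  rw [e1 p, pderiv_fun_const_mul (hφ' p)]

/-- The key polynomial inequality behind the strict subsolution: for `s ≥ 1` and `¼ + |E| + 40a < 8a²s²`,
`2a(11s² + 9) + ¼s⁴ + |E| < 8a²(1+s²)²s²`. [cite: Agmon1982, Ch. 5, remarks pp. 81–82] -/
theorem annulus_key_ineq {a E s : ℝ} (ha : 0 < a) (hs : 1 ≤ s) (hM : 1 / 4 + |E| + 40 * a < 8 * a ^ 2 * s ^ 2) :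
    2 * a * (11 * s ^ 2 + 9) + 1 / 4 * s ^ 4 + |E| < 8 * a ^ 2 * (1 + s ^ 2) ^ 2 * s ^ 2 := by
  have hE0 := abs_nonneg E
  have hs2 : 1 ≤ s ^ 2 := by nlinarith
  have hs4 : s ^ 2 ≤ s ^ 4 := by nlinarith
  have hs40 : 0 < s ^ 4 := by positivity
  -- `LHS ≤ (¼ + |E| + 40a) s⁴`
  have h1 : 2 * a * (11 * s ^ 2 + 9) + 1 / 4 * s ^ 4 + |E| ≤ (1 / 4 + |E| + 40 * a) * s ^ 4 := by
    have e1 : 2 * a * (11 * s ^ 2) ≤ 22 * a * s ^ 4 := by nlinarith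
    have e2 : 2 * a * 9 ≤ 18 * a * s ^ 4 := by nlinarith
    have e3 : |E| ≤ |E| * s ^ 4 := by nlinarith
    nlinarith
  -- `(¼ + |E| + 40a) s⁴ < 8a² s² s⁴ ≤ 8a² (1+s²)² s²`
  have h2 : (1 / 4 + |E| + 40 * a) * s ^ 4 < 8 * a ^ 2 * s ^ 2 * s ^ 4 := mul_lt_mul_of_pos_right hM hs40
  have h3 : 8 * a ^ 2 * s ^ 2 * s ^ 4 ≤ 8 * a ^ 2 * (1 + s ^ 2) ^ 2 * s ^ 2 := by
    have e : s ^ 4 ≤ (1 + s ^ 2) ^ 2 := by nlinarith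
    have h0 : 0 ≤ 8 * a ^ 2 * s ^ 2 := by positivity
    calc 8 * a ^ 2 * s ^ 2 * s ^ 4 ≤ 8 * a ^ 2 * s ^ 2 * (1 + s ^ 2) ^ 2 := mul_le_mul_of_nonneg_left e h0
      _ = 8 * a ^ 2 * (1 + s ^ 2) ^ 2 * s ^ 2 := by ring
  linarith

/-- **Strict subsolution**: for `a > 0`, `m > 0`, `1 ≤ r₀` with `¼ + |E| + 40a < 8a²r₀²`, the annulus comparison function `φ_{R₁}` satisfies
`(𝔥 − E)φ_{R₁}(x) < 0` whenever `r₀ < ‖x‖ < R₁`. [cite: Agmon1982, Ch. 5, remarks pp. 81–82] -/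
theorem annulusCmp_strictSub {a E m r₀ R₁ : ℝ} (ha : 0 < a) (hm : 0 < m) (hr₀ : 1 ≤ r₀) (hM : 1 / 4 + |E| + 40 * a < 8 * a ^ 2 * r₀ ^ 2)
    {x : ZM} (hxr : r₀ < ‖x‖) (hxR : ‖x‖ < R₁) :
    hApply (fun y : ZM => m * (Real.exp (-(a * (1 + ‖y‖ ^ 2) ^ 2)) - Real.exp (-(a * (1 + R₁ ^ 2) ^ 2)))) x -
      E * (m * (Real.exp (-(a * (1 + ‖x‖ ^ 2) ^ 2)) - Real.exp (-(a * (1 + R₁ ^ 2) ^ 2)))) < 0 := by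
  simp only [hApply_def, laplacian_annulusCmp]
  have hx1 : 1 ≤ ‖x‖ := hr₀.trans hxr.le
  have hM' : 1 / 4 + |E| + 40 * a < 8 * a ^ 2 * ‖x‖ ^ 2 := by
    have : r₀ ^ 2 ≤ ‖x‖ ^ 2 := pow_le_pow_left₀ (by linarith) hxr.le 2
    nlinarith
  have hkey := annulus_key_ineq (E := E) ha hx1 hM'
  have hD0 : 0 ≤ Real.exp (-(a * (1 + ‖x‖ ^ 2) ^ 2)) - Real.exp (-(a * (1 + R₁ ^ 2) ^ 2)) := by
    rw [sub_nonneg, Real.exp_le_exp]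
    have h1 : ‖x‖ ^ 2 ≤ R₁ ^ 2 := pow_le_pow_left₀ (norm_nonneg _) hxR.le 2
    have h2 : (1 + ‖x‖ ^ 2) ^ 2 ≤ (1 + R₁ ^ 2) ^ 2 := pow_le_pow_left₀ (by positivity) (by linarith) 2
    have h3 := mul_le_mul_of_nonneg_left h2 ha.le
    linarith
  have hDle : Real.exp (-(a * (1 + ‖x‖ ^ 2) ^ 2)) - Real.exp (-(a * (1 + R₁ ^ 2) ^ 2)) ≤ Real.exp (-(a * (1 + ‖x‖ ^ 2) ^ 2)) := by
    linarith [Real.exp_pos (-(a * (1 + R₁ ^ 2) ^ 2))]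
  have hV := luscherPotential_le_norm_pow_four x
  have hEabs : -E ≤ |E| := neg_le_abs E
  generalize hedef : Real.exp (-(a * (1 + ‖x‖ ^ 2) ^ 2)) = e₀ at hD0 hDle ⊢
  generalize hDdef : e₀ - Real.exp (-(a * (1 + R₁ ^ 2) ^ 2)) = D at hD0 hDle ⊢
  have he0 : 0 < e₀ := by rw [← hedef]; exact Real.exp_pos _
  generalize hVdef : luscherPotential x = V at hV ⊢
  generalize hsdef : ‖x‖ = s at hkey hV hx1 ⊢
  -- `(V − E)·(m D) ≤ (¼s⁴ + |E|)·(m e₀)` and `(¼s⁴ + |E|)(m e₀) < ½ (m e₀) P`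
  have hVE : (V - E) * (m * D) ≤ (1 / 4 * s ^ 4 + |E|) * (m * e₀) := by
    have h1 : (V - E) * (m * D) ≤ (1 / 4 * s ^ 4 + |E|) * (m * D) :=
      mul_le_mul_of_nonneg_right (by linarith) (mul_nonneg hm.le hD0)
    have h2 : (1 / 4 * s ^ 4 + |E|) * (m * D) ≤ (1 / 4 * s ^ 4 + |E|) * (m * e₀) :=
      mul_le_mul_of_nonneg_left (mul_le_mul_of_nonneg_left hDle hm.le) (by positivity)
    linarith
  have hme : 0 < m * e₀ := mul_pos hm he0
  have hfin := mul_lt_mul_of_pos_left hkey hme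
  linear_combination hVE + hfin

/-- **The lower bound in bracket form.**  For a positive `C²` solution `ψ` of `𝔥ψ = Eψ` and any `a > 0`: with
`M = ¼ + |E| + 40a`, `r₀ = 1 + M/(8a²)` and `m₀ = min_{‖y‖ ≤ r₀} ψ > 0`, one has `ψ(y) ≥ m₀ · e^{−a(1+‖y‖²)²}` for ALL `y`.
[cite: CarmonaSimon1981, §1] [cite: Agmon1982, Ch. 5, remarks pp. 81–82] -/
theorem groundState_lower_bound_bracket {ψ : ZM → ℝ} (hψ : ContDiff ℝ 2 ψ) (hpos : ∀ x, 0 < ψ x) {E : ℝ}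
    (heq : ∀ x, hApply ψ x = E * ψ x) {a : ℝ} (ha : 0 < a) :
    ∃ m₀ : ℝ, 0 < m₀ ∧ ∀ y : ZM, m₀ * Real.exp (-(a * (1 + ‖y‖ ^ 2) ^ 2)) ≤ ψ y := by
  -- thresholds
  set M : ℝ := 1 / 4 + |E| + 40 * a with hM
  have hM0 : 0 < M := by have := abs_nonneg E; positivity
  set r₀ : ℝ := 1 + M / (8 * a ^ 2) with hr₀
  have hMa : 0 ≤ M / (8 * a ^ 2) := by positivity
  have hr₀1 : 1 ≤ r₀ := by linarith
  have hMr : 1 / 4 + |E| + 40 * a < 8 * a ^ 2 * r₀ ^ 2 := by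
    have h1 : M / (8 * a ^ 2) < r₀ := by linarith
    have h2 : M < 8 * a ^ 2 * r₀ := by
      have := (div_lt_iff₀ (by positivity : (0:ℝ) < 8 * a ^ 2)).mp h1; linarith
    have h3 : 8 * a ^ 2 * r₀ ≤ 8 * a ^ 2 * r₀ ^ 2 := by
      have : r₀ ≤ r₀ ^ 2 := by nlinarith
      exact mul_le_mul_of_nonneg_left this (by positivity)
    linarith
  -- the minimum of `ψ` on the closed ball
  obtain ⟨z, -, hzmin⟩ := (isCompact_closedBall (0 : ZM) r₀).exists_isMinOn ⟨0, Metric.mem_closedBall_self (by linarith)⟩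
    hψ.continuous.continuousOn
  have hm₀pos : 0 < ψ z := hpos z
  have hball : ∀ y : ZM, ‖y‖ ≤ r₀ → ψ z ≤ ψ y := fun y hy => hzmin (by simpa [Metric.mem_closedBall, dist_zero_right] using hy)
  refine ⟨ψ z, hm₀pos, fun y => ?_⟩
  generalize hm₀ : ψ z = m₀ at hm₀pos hball ⊢
  have hexp1 : ∀ u : ZM, Real.exp (-(a * (1 + ‖u‖ ^ 2) ^ 2)) ≤ 1 := fun u => by
    rw [Real.exp_le_one_iff]; have : 0 ≤ a * (1 + ‖u‖ ^ 2) ^ 2 := by positivity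
    linarith
  by_cases hy : ‖y‖ ≤ r₀
  · -- inside the ball: `m₀ e^{−h} ≤ m₀ ≤ ψ`
    calc m₀ * Real.exp (-(a * (1 + ‖y‖ ^ 2) ^ 2)) ≤ m₀ * 1 := mul_le_mul_of_nonneg_left (hexp1 y) hm₀pos.le
      _ = m₀ := mul_one _
      _ ≤ ψ y := hball y hy
  · push Not at hy
    -- outside: the annulus comparison for every `R₁ ≥ ‖y‖`, then `R₁ → ∞`
    have hann : ∀ R₁ : ℝ, ‖y‖ ≤ R₁ →
        m₀ * (Real.exp (-(a * (1 + ‖y‖ ^ 2) ^ 2)) - Real.exp (-(a * (1 + R₁ ^ 2) ^ 2))) ≤ ψ y := by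
      intro R₁ hR₁
      -- the compact annulus `K` and its interior `Ω`
      have hKc : IsCompact {x : ZM | r₀ ≤ ‖x‖ ∧ ‖x‖ ≤ R₁} := by
        refine Metric.isCompact_of_isClosed_isBounded ?_ ?_
        · exact (isClosed_le continuous_const continuous_norm).inter (isClosed_le continuous_norm continuous_const)
        · refine (Metric.isBounded_closedBall (x := (0 : ZM)) (r := R₁)).subset fun x hx => ?_
          simpa [Metric.mem_closedBall, dist_zero_right] using hx.2
      have hΩo : IsOpen {x : ZM | r₀ < ‖x‖ ∧ ‖x‖ < R₁} :=
        (isOpen_lt continuous_const continuous_norm).inter (isOpen_lt continuous_norm continuous_const)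
      have hΩK : {x : ZM | r₀ < ‖x‖ ∧ ‖x‖ < R₁} ⊆ {x : ZM | r₀ ≤ ‖x‖ ∧ ‖x‖ ≤ R₁} := fun x hx => ⟨hx.1.le, hx.2.le⟩
      have hcmp := le_of_strict_subsolution (E := E) hKc hΩo hΩK hψ (contDiff_annulusCmp a m₀ R₁) hpos heq ?_ ?_ y ⟨hy.le, hR₁⟩
      · exact hcmp
      · -- strict subsolution on `Ω`
        intro x hx
        have h := annulusCmp_strictSub (E := E) ha hm₀pos hr₀1 hMr hx.1 hx.2
        show hApply (fun y : ZM => m₀ * (Real.exp (-(a * (1 + ‖y‖ ^ 2) ^ 2)) - Real.exp (-(a * (1 + R₁ ^ 2) ^ 2)))) x <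
          E * (m₀ * (Real.exp (-(a * (1 + ‖x‖ ^ 2) ^ 2)) - Real.exp (-(a * (1 + R₁ ^ 2) ^ 2))))
        linarith
      · -- boundary spheres
        intro x hxK hxΩ
        show m₀ * (Real.exp (-(a * (1 + ‖x‖ ^ 2) ^ 2)) - Real.exp (-(a * (1 + R₁ ^ 2) ^ 2))) ≤ ψ x
        have hcases : ‖x‖ = r₀ ∨ ‖x‖ = R₁ := by
          by_contra hcon
          push Not at hcon
          exact hxΩ ⟨lt_of_le_of_ne hxK.1 (Ne.symm hcon.1), lt_of_le_of_ne hxK.2 hcon.2⟩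
        rcases hcases with hx | hx
        · -- inner sphere
          have h1 : Real.exp (-(a * (1 + ‖x‖ ^ 2) ^ 2)) - Real.exp (-(a * (1 + R₁ ^ 2) ^ 2)) ≤ 1 := by
            linarith [hexp1 x, Real.exp_pos (-(a * (1 + R₁ ^ 2) ^ 2))]
          calc m₀ * (Real.exp (-(a * (1 + ‖x‖ ^ 2) ^ 2)) - Real.exp (-(a * (1 + R₁ ^ 2) ^ 2))) ≤ m₀ * 1 :=
                mul_le_mul_of_nonneg_left h1 hm₀pos.le
            _ ≤ ψ x := by rw [mul_one]; exact hball x hx.le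
        · -- outer sphere
          rw [hx, sub_self, mul_zero]
          exact (hpos x).le
    -- the limit `R₁ → ∞`
    have hlim : Tendsto (fun R₁ : ℝ => m₀ * (Real.exp (-(a * (1 + ‖y‖ ^ 2) ^ 2)) - Real.exp (-(a * (1 + R₁ ^ 2) ^ 2)))) atTop
        (𝓝 (m₀ * (Real.exp (-(a * (1 + ‖y‖ ^ 2) ^ 2)) - 0))) := by
      refine tendsto_const_nhds.mul (tendsto_const_nhds.sub ?_)
      refine Real.tendsto_exp_atBot.comp ?_
      refine tendsto_neg_atTop_atBot.comp ?_
      refine Tendsto.const_mul_atTop ha ?_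
      refine tendsto_atTop_mono (fun R₁ => ?_) tendsto_id
      show R₁ ≤ (1 + R₁ ^ 2) ^ 2
      nlinarith [sq_nonneg (R₁ - 1), sq_nonneg R₁, sq_nonneg (R₁ ^ 2)]
    rw [sub_zero] at hlim
    exact le_of_tendsto hlim (Filter.eventually_atTop.mpr ⟨‖y‖, fun R₁ hR₁ => hann R₁ hR₁⟩)

/-- ★ **Quartic-Gaussian lower bound for positive eigenfunctions of Lüscher's Hamiltonian.**  If `ψ ∈ C²(ℝ⁹)`, `ψ > 0`, solves
`𝔥ψ = Eψ` pointwise (`𝔥 = −½Δ + V`, `V` = `luscherPotential`), then for every `a > 0` there is `c > 0` with `c · e^{−a‖y‖⁴} ≤ ψ(y)` for all `y`.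
(The sharp rate is Carmona–Simon's `e^{−a|y|³}`, `V = O(|y|⁴)`; the quartic rate with ARBITRARY `a` is what the elementary comparison gives and what the
consumer — the one-site transplant observables of route `LuscherReduction` — needs.) [cite: CarmonaSimon1981, §1] [cite: Agmon1982, Ch. 5, remarks pp. 81–82] -/
theorem groundState_lower_bound_quartic {ψ : ZM → ℝ} (hψ : ContDiff ℝ 2 ψ) (hpos : ∀ x, 0 < ψ x) {E : ℝ}
    (heq : ∀ x, hApply ψ x = E * ψ x) {a : ℝ} (ha : 0 < a) :
    ∃ c : ℝ, 0 < c ∧ ∀ y : ZM, c * Real.exp (-(a * ‖y‖ ^ 4)) ≤ ψ y := by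
  obtain ⟨m₀, hm₀, h⟩ := groundState_lower_bound_bracket hψ hpos heq (a := a / 2) (by positivity)
  refine ⟨m₀ * Real.exp (-a), by positivity, fun y => ?_⟩
  have h1 := h y
  have hmono : Real.exp (-a) * Real.exp (-(a * ‖y‖ ^ 4)) ≤ Real.exp (-(a / 2 * (1 + ‖y‖ ^ 2) ^ 2)) := by
    rw [← Real.exp_add, Real.exp_le_exp]
    nlinarith [sq_nonneg (‖y‖ ^ 2 - 1), ha.le]
  calc m₀ * Real.exp (-a) * Real.exp (-(a * ‖y‖ ^ 4)) = m₀ * (Real.exp (-a) * Real.exp (-(a * ‖y‖ ^ 4))) := by ring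
    _ ≤ m₀ * Real.exp (-(a / 2 * (1 + ‖y‖ ^ 2) ^ 2)) := mul_le_mul_of_nonneg_left hmono hm₀.le
    _ ≤ ψ y := h1

/-- ★★ **The registered text of record** (LEAD ym-lead-20205-polyakovlift, fleet bus 2026-08-27 20:16:27Z (ii), verbatim binders): every positive `C²`
solution of `𝔥ψ = Eψ` is bounded below by `c_a · e^{−a‖y‖⁴}` for EVERY `a > 0`.  This is the statement the r7/r8 skeleton of crux `DressedRitz`
(line «polyakovlift», `stub_pscaling`) imports in place of a named hypothesis. [cite: CarmonaSimon1981, §1] [cite: Agmon1982, Ch. 5, remarks pp. 81–82] -/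
theorem luscherGroundStateLowerBound :
    ∀ (ψ : ZM → ℝ) (E : ℝ), ContDiff ℝ 2 ψ → (∀ x, 0 < ψ x) → (∀ x, hApply ψ x = E * ψ x) →
      ∀ a : ℝ, 0 < a → ∃ c : ℝ, 0 < c ∧ ∀ y, c * Real.exp (-(a * ‖y‖ ^ 4)) ≤ ψ y :=
  fun _ _ hψ hpos heq _ ha => groundState_lower_bound_quartic hψ hpos heq ha

end LowerBound

end Literature.Analysis.OperatorTheory.YMMatrixModel

end
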